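import Mathlib
import Summits.PneNP.PneNP.Theorems.OverlapGapAlgebraSolvableImpliesStableSectionSequentialLocalTransfer

/-!
# PneNP / OverlapGapAlgebra — `SearchHardWindow`: the index-order UNIT CLAUSE rule is a sequential
# local rule — Unit Clause without reordering fails in the Bresler–Huang window

Support for crux `stmt-PneNP-2460` (`Summit.PneNP.PneNP.Theses.OverlapGapAlgebra.SearchHardWindow`).
A concrete, classical member of the class of index-order decimation rules with unit look-ahead
(`…SequentialLocalRung`): the UNIT CLAUSE rule run in the fixed variable order `0, 1, …, n-1`
(hypothesis `hUC`, definition-free): when variable `v` is reached, a clause is UNIT FOR `v` if it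
contains `v` and all its other literals sit on smaller variables and are falsified by the bits already
assigned; `v` is set so as to satisfy a unit clause asking for `true` if there is one, else `false` if
some unit clause asks for `false`, else `true` (free step). This is the Unit Clause heuristic of
Chao–Franco (1986/1990) with the free steps taken in index order and without the unit-propagation
reordering.

* `shwSeq_unitClause_isSeqLocal` — any map satisfying `hUC` is an index-order decimation rule with
  unit look-ahead (hypothesis `hseq` of `shwSeq_meanSquare`);
* `shwSeq_unitClauseMapsFail_rate` — hence, UNCONDITIONALLY, for `k ≥ k₀`: eventually in `n` every
  such map solves at most a `C log² n / n` fraction of `F_k(n, ⌊α_k n⌋)`, `α_k = 5·2^k log k / k`;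
* `shwSeq_unitClause_stableSection_of_solvable` — and at every density the conclusion of
  `SolvableImpliesStableSection` holds whenever such a map solves an `ε`-fraction infinitely often.
No definitions; axioms `propext`, `Classical.choice`, `Quot.sound`.
-/

set_option linter.dupNamespace false -- `Summit.PneNP.PneNP.…`: summit = sub-problem (D-0017)

namespace Summit.PneNP.PneNP.Theorems

open Finset Filter Asymptotics
open scoped Classical

section UnitClause

variable {m k n : ℕ}

/-- **The index-order Unit Clause rule is a sequential local rule.** If `g Φ v` is `true` iff
(some clause unit for `v` under the bits of `g Φ` at smaller variables asks for `true`) or (no such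
clause asks for `false`), then `g` is an index-order decimation rule with unit look-ahead. -/
theorem shwSeq_unitClause_isSeqLocal (g : (Fin m → Fin k → Fin n × Bool) → (Fin n → Bool))
    (hUC : ∀ (Φ : (Fin m → Fin k → Fin n × Bool)) (v : Fin n), g Φ v = decide
      ((∃ (i : Fin m) (j : Fin k), ((Φ i j).1 = v ∧ ∀ j'' : Fin k, j'' ≠ j →
          ((Φ i j'').1 < v ∧ g Φ (Φ i j'').1 ≠ (Φ i j'').2)) ∧ (Φ i j).2 = true) ∨
        ¬ ∃ (i : Fin m) (j : Fin k), ((Φ i j).1 = v ∧ ∀ j'' : Fin k, j'' ≠ j →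
          ((Φ i j'').1 < v ∧ g Φ (Φ i j'').1 ≠ (Φ i j'').2)) ∧ (Φ i j).2 = false)) :
    (∀ (Φ Φ' : (Fin m → Fin k → Fin n × Bool)) (v : Fin n),
        (∀ i : Fin m, ((∃ j : Fin k, (Φ i j).1 = v) ∨ (∃ j : Fin k, (Φ' i j).1 = v)) → Φ i = Φ' i) →
        (∀ (i : Fin m) (j j' : Fin k), (Φ i j).1 = v → (Φ i j').1 < v →
          g Φ (Φ i j').1 = g Φ' (Φ i j').1) →
        g Φ v = g Φ' v) := by
  intro Φ Φ' v H1 H2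
  -- unit clauses for `v` are the same in `Φ` and `Φ'`
  have hunit : ∀ (i : Fin m) (j : Fin k) (s : Bool),
      (((Φ i j).1 = v ∧ ∀ j'' : Fin k, j'' ≠ j →
          ((Φ i j'').1 < v ∧ g Φ (Φ i j'').1 ≠ (Φ i j'').2)) ∧ (Φ i j).2 = s) ↔
      (((Φ' i j).1 = v ∧ ∀ j'' : Fin k, j'' ≠ j →
          ((Φ' i j'').1 < v ∧ g Φ' (Φ' i j'').1 ≠ (Φ' i j'').2)) ∧ (Φ' i j).2 = s) := by
    intro i j s
    constructor
    · rintro ⟨⟨hv, hoth⟩, hs⟩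
      have hi : Φ i = Φ' i := H1 i (Or.inl ⟨j, hv⟩)
      refine ⟨⟨by rw [← hi]; exact hv, fun j'' hj'' => ?_⟩, by rw [← hi]; exact hs⟩
      obtain ⟨hlt, hval⟩ := hoth j'' hj''
      refine ⟨by rw [← hi]; exact hlt, ?_⟩
      rw [← hi, ← H2 i j j'' hv hlt]
      exact hval
    · rintro ⟨⟨hv, hoth⟩, hs⟩
      have hi : Φ i = Φ' i := H1 i (Or.inr ⟨j, hv⟩)
      refine ⟨⟨by rw [hi]; exact hv, fun j'' hj'' => ?_⟩, by rw [hi]; exact hs⟩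
      obtain ⟨hlt, hval⟩ := hoth j'' hj''
      have hlt' : (Φ i j'').1 < v := by rw [hi]; exact hlt
      have hv' : (Φ i j).1 = v := by rw [hi]; exact hv
      refine ⟨hlt', ?_⟩
      rw [H2 i j j'' hv' hlt', hi]
      exact hval
  rw [hUC Φ v, hUC Φ' v]
  apply decide_eq_decide.2
  have hT : (∃ (i : Fin m) (j : Fin k), ((Φ i j).1 = v ∧ ∀ j'' : Fin k, j'' ≠ j →
          ((Φ i j'').1 < v ∧ g Φ (Φ i j'').1 ≠ (Φ i j'').2)) ∧ (Φ i j).2 = true) ↔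
      (∃ (i : Fin m) (j : Fin k), ((Φ' i j).1 = v ∧ ∀ j'' : Fin k, j'' ≠ j →
          ((Φ' i j'').1 < v ∧ g Φ' (Φ' i j'').1 ≠ (Φ' i j'').2)) ∧ (Φ' i j).2 = true) := by
    constructor
    · rintro ⟨i, j, h⟩; exact ⟨i, j, (hunit i j true).1 h⟩
    · rintro ⟨i, j, h⟩; exact ⟨i, j, (hunit i j true).2 h⟩
  have hF : (∃ (i : Fin m) (j : Fin k), ((Φ i j).1 = v ∧ ∀ j'' : Fin k, j'' ≠ j →
          ((Φ i j'').1 < v ∧ g Φ (Φ i j'').1 ≠ (Φ i j'').2)) ∧ (Φ i j).2 = false) ↔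
      (∃ (i : Fin m) (j : Fin k), ((Φ' i j).1 = v ∧ ∀ j'' : Fin k, j'' ≠ j →
          ((Φ' i j'').1 < v ∧ g Φ' (Φ' i j'').1 ≠ (Φ' i j'').2)) ∧ (Φ' i j).2 = false) := by
    constructor
    · rintro ⟨i, j, h⟩; exact ⟨i, j, (hunit i j false).1 h⟩
    · rintro ⟨i, j, h⟩; exact ⟨i, j, (hunit i j false).2 h⟩
  rw [hT, hF]

/-- **Unit Clause without reordering fails in the Bresler–Huang window (unconditional, with a
rate).** For all `k ≥ k₀` there is `C > 0` such that, eventually in `n`, every map on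
`F_k(n, ⌊α_k n⌋)` satisfying the index-order Unit Clause recursion `hUC` solves at most a
`C log² n / n` fraction of the instances. -/
theorem shwSeq_unitClauseMapsFail_rate :
    ∃ k₀ : ℕ, ∀ k : ℕ, k₀ ≤ k → ∃ C : ℝ, 0 < C ∧
      ∀ᶠ n : ℕ in atTop, ∀ m : ℕ, m = ⌊5 * 2 ^ k * Real.log k / k * n⌋₊ →
        ∀ g : (Fin m → Fin k → Fin n × Bool) → (Fin n → Bool),
          (∀ (Φ : Fin m → Fin k → Fin n × Bool) (v : Fin n), g Φ v = decide
            ((∃ (i : Fin m) (j : Fin k), ((Φ i j).1 = v ∧ ∀ j'' : Fin k, j'' ≠ j →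
                ((Φ i j'').1 < v ∧ g Φ (Φ i j'').1 ≠ (Φ i j'').2)) ∧ (Φ i j).2 = true) ∨
              ¬ ∃ (i : Fin m) (j : Fin k), ((Φ i j).1 = v ∧ ∀ j'' : Fin k, j'' ≠ j →
                ((Φ i j'').1 < v ∧ g Φ (Φ i j'').1 ≠ (Φ i j'').2)) ∧ (Φ i j).2 = false)) →
          ((Finset.univ.filter fun Φ : Fin m → Fin k → Fin n × Bool =>
              ∀ i, ∃ j, g Φ (Φ i j).1 = (Φ i j).2).card : ℝ)
            ≤ C * Real.log n ^ 2 / n * Fintype.card (Fin m → Fin k → Fin n × Bool) := by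
  obtain ⟨k₀, h⟩ := shwSeq_seqLocalMapsFail_rate
  refine ⟨k₀, fun k hk => ?_⟩
  obtain ⟨C, hC, hev⟩ := h k hk
  refine ⟨C, hC, ?_⟩
  filter_upwards [hev] with n hn m hm g hUC
  exact hn m hm g (shwSeq_unitClause_isSeqLocal g hUC)

/-- **Unit Clause solvers give stable sections (every density).** For every `k ≥ 1`,
`α, η, ν, ε > 0`: if, for infinitely many `n`, some map satisfying the index-order Unit Clause
recursion solves at least an `ε`-fraction of `F_k(n, ⌊αn⌋₊)`, then the conclusion of
`SolvableImpliesStableSection` holds at `(k, α, η, ν)` for every `c > 0`. -/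
theorem shwSeq_unitClause_stableSection_of_solvable (k : ℕ) (hk : 1 ≤ k) (α η ν : ℝ)
    (hα : 0 < α) (hη : 0 < η) (hν : 0 < ν) (ε : ℝ) (hε : 0 < ε)
    (hsolv : ∃ᶠ n : ℕ in atTop, ∀ m : ℕ, m = ⌊α * n⌋₊ →
      ∃ g : (Fin m → Fin k → Fin n × Bool) → (Fin n → Bool),
        (∀ (Φ : Fin m → Fin k → Fin n × Bool) (v : Fin n), g Φ v = decide
          ((∃ (i : Fin m) (j : Fin k), ((Φ i j).1 = v ∧ ∀ j'' : Fin k, j'' ≠ j →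
              ((Φ i j'').1 < v ∧ g Φ (Φ i j'').1 ≠ (Φ i j'').2)) ∧ (Φ i j).2 = true) ∨
            ¬ ∃ (i : Fin m) (j : Fin k), ((Φ i j).1 = v ∧ ∀ j'' : Fin k, j'' ≠ j →
              ((Φ i j'').1 < v ∧ g Φ (Φ i j'').1 ≠ (Φ i j'').2)) ∧ (Φ i j).2 = false)) ∧
        ε * Fintype.card (Fin m → Fin k → Fin n × Bool) ≤
          ((Finset.univ.filter fun Φ : Fin m → Fin k → Fin n × Bool =>
            ∀ i, ∃ j, g Φ (Φ i j).1 = (Φ i j).2).card : ℝ))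
    (c : ℝ) (hc : 0 < c) :
    ∃ᶠ n : ℕ in atTop, ∀ m : ℕ, m = ⌊α * n⌋₊ →
      ∃ g : (Fin m → Fin k → Fin n × Bool) → (Fin n → Bool),
        Real.exp (-(c * n)) * Fintype.card (Fin (k + 1) → Fin m → Fin k → Fin n × Bool) ≤
        ((Finset.univ.filter fun Ψ : Fin (k + 1) → Fin m → Fin k → Fin n × Bool =>
          let P : Fin k → ℕ → Fin m → Fin k → Fin n × Bool :=
            fun r q a b => if (a : ℕ) * k + b < q then Ψ r.succ a b else Ψ r.castSucc a b
          (∀ r : Fin k, ∀ q ≤ m * k, ((Finset.univ.filter fun i : Fin m =>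
            ∀ j, g (P r q) (P r q i j).1 ≠ (P r q i j).2).card : ℝ) ≤ ν * m) ∧
          ∀ r : Fin k, ∀ q < m * k,
            (hammingDist (g (P r q)) (g (P r (q + 1))) : ℝ) ≤ η * n).card : ℝ) := by
  refine sissSeq_concl_of_seqLocalSolver k hk α η ν hα hη hν ε hε ?_ c hc
  refine hsolv.mono fun n hn m hm => ?_
  obtain ⟨g, hUC, hsucc⟩ := hn m hm
  exact ⟨g, shwSeq_unitClause_isSeqLocal g hUC, hsucc⟩

end UnitClause

end Summit.PneNP.PneNP.Theorems
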